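import Summits.BirchSwinnertonDyer.BirchSwinnertonDyer.Theorems.ManinLocalTwoThreeTameTwoKummerBlind
import HarnessLib

/-!
# Kummer-blindness at `2` needs `ord₂ Δ_min ≥ 8`; for an odd Vélu `B` it IS `ord₂ Δ_min ≥ 8` (tame or wild)

Summit `BirchSwinnertonDyer`, route `ManinLocalTwoThree` (cell bsd-f2-manin), deciding crux C2 `ManinOddAtFour`
(stmt-BirchSwinnertonDyer-22967).  p648738's identity `disc(x³ + a₂x² + a₄x + a₆) = (b² − 4c)·B²` on a root `e` (`b = a₂ + e`, `c = a₄ + be`,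
`B = 3e² + 2a₂e + a₄`) and `Δ = 16·disc` on a globally minimal `[0, a₂, 0, a₄, a₆]` give, for EVERY curve with `4 ∣ N` written that way (the
wild ones included):

* `not_kummerBlindAtTwo_of_padicValInt_le_seven` — `ord₂ Δ_min ≤ 7` ⟹ no rational `2`-torsion point is Kummer-blind (`16 ∤ b² − 4c`);
* `kummerBlindAtTwo_of_eight_le_of_odd_veluB` — `ord₂ Δ_min ≥ 8` and `B` odd ⟹ Kummer-blind;
* `kummerBlindAtTwo_iff_eight_le_of_odd_veluB` — for `B` odd: blind ⟺ `ord₂ Δ_min ≥ 8`.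

(On the tame cell `B` is odd on `IV*` and `ord₂ Δ_min = 4` on `IV`: p646508/p647511/p648738.)  HONEST FRAMING: local; C2, Manin's conjecture and
BSD are not proved.  No definitions, no named facts, no sorry.  References: [SilvermanATAEC1994] IV.9.4 Table 4.1; HOME/MEMO-an.md §56, §64, §67.
-/

set_option autoImplicit false
set_option linter.dupNamespace false

noncomputable section

open scoped Classical
open Polynomial WeierstrassCurve
open Summit.BirchSwinnertonDyer.Rank1Residual.ManinAdditive.CuspidalKummer
open Summit.BirchSwinnertonDyer.Rank1Residual.ManinAdditive.ShimuraLedger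

namespace Summit.BirchSwinnertonDyer.BirchSwinnertonDyer.Theorems.ManinLocalTwoThree

/-- The integer model of a globally minimal `[0, a₂, 0, a₄, a₆]` curve with an integer reading of a rational `2`-torsion root: the cubic
relation, and `Δ_min = 16·disc`. [folklore] -/
theorem disc_of_integralModel_of_root (W : WeierstrassCurve ℚ) [W.IsElliptic] [W.IsGloballyMinimal] (ha₁ : W.a₁ = 0) (ha₃ : W.a₃ = 0)
    {e : ℚ} (he : e ^ 3 + W.a₂ * e ^ 2 + W.a₄ * e + W.a₆ = 0) (A₂ A₄ E : ℤ) (hA₂ : (A₂ : ℚ) = W.a₂) (hA₄ : (A₄ : ℚ) = W.a₄)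
    (hE : (E : ℚ) = e) :
    ∃ A₆ : ℤ, E ^ 3 + A₂ * E ^ 2 + A₄ * E + A₆ = 0 ∧
      W.minimalDiscriminantInt = 16 * (A₂ ^ 2 * A₄ ^ 2 - 4 * A₄ ^ 3 - 4 * A₂ ^ 3 * A₆ + 18 * A₂ * A₄ * A₆ - 27 * A₆ ^ 2) := by
  set M : WeierstrassCurve ℤ := integralModelInt W with hM
  have hWM : M.map (Int.castRingHom ℚ) = W := map_integralModelInt W
  have h1 : W.a₁ = (M.a₁ : ℚ) := by rw [← hWM, map_a₁, eq_intCast]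
  have h2 : W.a₂ = (M.a₂ : ℚ) := by rw [← hWM, map_a₂, eq_intCast]
  have h3 : W.a₃ = (M.a₃ : ℚ) := by rw [← hWM, map_a₃, eq_intCast]
  have h4a : W.a₄ = (M.a₄ : ℚ) := by rw [← hWM, map_a₄, eq_intCast]
  have h6 : W.a₆ = (M.a₆ : ℚ) := by rw [← hWM, map_a₆, eq_intCast]
  have hM1 : M.a₁ = 0 := by exact_mod_cast (h1.symm.trans ha₁)
  have hM3 : M.a₃ = 0 := by exact_mod_cast (h3.symm.trans ha₃)
  have hA₂' : A₂ = M.a₂ := by exact_mod_cast (hA₂.trans h2)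
  have hA₄' : A₄ = M.a₄ := by exact_mod_cast (hA₄.trans h4a)
  refine ⟨M.a₆, ?_, ?_⟩
  · have h : ((E ^ 3 + A₂ * E ^ 2 + A₄ * E + M.a₆ : ℤ) : ℚ) = 0 := by
      push_cast; rw [hE, hA₂, hA₄, ← h6]; exact he
    exact_mod_cast h
  · have hMΔ : M.Δ = 16 * (A₂ ^ 2 * A₄ ^ 2 - 4 * A₄ ^ 3 - 4 * A₂ ^ 3 * M.a₆ + 18 * A₂ * A₄ * M.a₆ - 27 * M.a₆ ^ 2) := by
      rw [hA₂', hA₄']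
      simp only [WeierstrassCurve.Δ, WeierstrassCurve.b₂, WeierstrassCurve.b₄, WeierstrassCurve.b₆, WeierstrassCurve.b₈, hM1, hM3]
      ring
    have hmin : W.minimalDiscriminantInt = M.Δ := by
      have h1' : (W.minimalDiscriminantInt : ℚ) = W.Δ := cast_minimalDiscriminantInt W
      have h2' : W.Δ = (M.Δ : ℚ) := by rw [← hWM, map_Δ, eq_intCast]
      exact_mod_cast h1'.trans h2'
    rw [hmin, hMΔ]

/-- **Kummer-blindness needs `ord₂ Δ_min ≥ 8`:** `W = [0, a₂, 0, a₄, a₆]` globally minimal with `ord₂ Δ_min ≤ 7` ⟹ no rational `2`-torsion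
point is Kummer-blind (`Δ_min = 16·(b² − 4c)·B²`, so `16 ∣ b² − 4c` would give `2⁸ ∣ Δ_min`). [cite: SilvermanATAEC1994, IV.9.4 Table 4.1] -/
theorem not_kummerBlindAtTwo_of_padicValInt_le_seven (W : WeierstrassCurve ℚ) [W.IsElliptic] [W.IsGloballyMinimal] (ha₁ : W.a₁ = 0)
    (ha₃ : W.a₃ = 0) (hΔ : padicValInt 2 W.minimalDiscriminantInt ≤ 7) {e : ℚ} (he : e ^ 3 + W.a₂ * e ^ 2 + W.a₄ * e + W.a₆ = 0)
    (A₂ A₄ E : ℤ) (hA₂ : (A₂ : ℚ) = W.a₂) (hA₄ : (A₄ : ℚ) = W.a₄) (hE : (E : ℚ) = e) : ¬ KummerBlindAtTwo A₂ A₄ E := by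
  haveI : Fact (Nat.Prime 2) := ⟨Nat.prime_two⟩
  obtain ⟨A₆, heZ, hmin⟩ := disc_of_integralModel_of_root W ha₁ ha₃ he A₂ A₄ E hA₂ hA₄ hE
  rintro ⟨-, h16⟩
  obtain ⟨n, hn⟩ := h16
  have h256 : ((2 : ℕ) : ℤ) ^ 8 ∣ W.minimalDiscriminantInt := by
    refine ⟨n * (3 * E ^ 2 + 2 * A₂ * E + A₄) ^ 2, ?_⟩
    rw [hmin, cubicDisc_eq_of_root heZ, hn]; push_cast; ring
  rw [padicValInt_dvd_iff] at h256
  rcases h256 with h0 | h8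
  · exact minimalDiscriminantInt_ne_zero W h0
  · omega

/-- **`ord₂ Δ_min ≥ 8` and `B` odd ⟹ Kummer-blind** (`2⁴ ∣ disc = (b² − 4c)B²` with `B` odd). [cite: SilvermanATAEC1994, IV.9.4 Table 4.1] -/
theorem kummerBlindAtTwo_of_eight_le_of_odd_veluB (W : WeierstrassCurve ℚ) [W.IsElliptic] [W.IsGloballyMinimal] (ha₁ : W.a₁ = 0)
    (ha₃ : W.a₃ = 0) (hΔ : 8 ≤ padicValInt 2 W.minimalDiscriminantInt) {e : ℚ} (he : e ^ 3 + W.a₂ * e ^ 2 + W.a₄ * e + W.a₆ = 0)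
    (A₂ A₄ E : ℤ) (hA₂ : (A₂ : ℚ) = W.a₂) (hA₄ : (A₄ : ℚ) = W.a₄) (hE : (E : ℚ) = e) (hB : ¬ (2 : ℤ) ∣ 3 * E ^ 2 + 2 * A₂ * E + A₄) :
    KummerBlindAtTwo A₂ A₄ E := by
  haveI : Fact (Nat.Prime 2) := ⟨Nat.prime_two⟩
  obtain ⟨A₆, heZ, hmin⟩ := disc_of_integralModel_of_root W ha₁ ha₃ he A₂ A₄ E hA₂ hA₄ hE
  refine kummerBlindAtTwo_of_sixteen_dvd_cubicDisc heZ ?_ hB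
  have h256 : ((2 : ℕ) : ℤ) ^ 8 ∣ W.minimalDiscriminantInt := (padicValInt_dvd_iff (p := 2) 8 _).mpr (Or.inr hΔ)
  rw [hmin, show ((2 : ℕ) : ℤ) ^ 8 = 16 * 2 ^ 4 by norm_num] at h256
  exact (mul_dvd_mul_iff_left (by norm_num : (16 : ℤ) ≠ 0)).mp h256

/-- **For an odd Vélu `B`: Kummer-blind ⟺ `ord₂ Δ_min ≥ 8`.** [cite: SilvermanATAEC1994, IV.9.4 Table 4.1] -/
theorem kummerBlindAtTwo_iff_eight_le_of_odd_veluB (W : WeierstrassCurve ℚ) [W.IsElliptic] [W.IsGloballyMinimal] (ha₁ : W.a₁ = 0)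
    (ha₃ : W.a₃ = 0) {e : ℚ} (he : e ^ 3 + W.a₂ * e ^ 2 + W.a₄ * e + W.a₆ = 0) (A₂ A₄ E : ℤ) (hA₂ : (A₂ : ℚ) = W.a₂)
    (hA₄ : (A₄ : ℚ) = W.a₄) (hE : (E : ℚ) = e) (hB : ¬ (2 : ℤ) ∣ 3 * E ^ 2 + 2 * A₂ * E + A₄) :
    KummerBlindAtTwo A₂ A₄ E ↔ 8 ≤ padicValInt 2 W.minimalDiscriminantInt := by
  constructor
  · intro h
    by_contra hlt
    exact not_kummerBlindAtTwo_of_padicValInt_le_seven W ha₁ ha₃ (by omega) he A₂ A₄ E hA₂ hA₄ hE h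
  · intro h8
    exact kummerBlindAtTwo_of_eight_le_of_odd_veluB W ha₁ ha₃ h8 he A₂ A₄ E hA₂ hA₄ hE hB

end Summit.BirchSwinnertonDyer.BirchSwinnertonDyer.Theorems.ManinLocalTwoThree

end
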